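import Literature.AnabelianGeometry.SemiGraphs.SemiGraph

/-!
# Semi-graphs: compactification and the local semi-graphs `G[v]`, `G[e]`, `G[b]` ([SemiAnbd] §1, pp. 13–14)

Mochizuki, *Semi-graphs of anabelioids*, Publ. RIMS **42** (2006) 221–322, §1, author's manuscript
pp. 13–14 [cite: MochizukiSemiAnbd2006, §1 pp.13-14].  Continuing `SemiGraph.lean`:

* the *compactification* of a semi-graph (p. 13): append, for each branch `b` that abuts to no
  vertex, a new vertex `v_b` to which `b` is to abut; the morphism `G → G̅`; functoriality ("any
  morphism of semi-graphs induces a unique morphism between the respective compactifications");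
* the local semi-graphs `G[v] → G`, `G[e] → G`, `G[b] → G` and `G[b] → G[v]`, `G[b] → G[e]` (p. 13);
* the observations of p. 14: `G[v] → G`, `G[b] → G[e]` are excisive, `G[e] → G`, `G[b] → G`,
  `G[b] → G[v]` are immersive — PROVED; "`G[v]`, `G[e]`, `G[b]` are all trees" — NAMED FACT.

Rendering: `G[v]` has vertex set `PUnit`, edge set the branches `b_v` abutting to `v` (one new edge
`e'_{b_v}` of verticial cardinality `1` over the edge of `b_v`), and as branches of `e'_{b_v}` the
branches of that edge, the one lying over `b_v` abutting to the vertex; `G[e]` has one edge, its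
branches those of `e`, and one vertex for each branch of `e` that abuts to a vertex; `G[b]` is the
sub-semi-graph of `G[e_b]` given by the unique edge and the vertex of the branch `b`.

Deliberately NOT here: the topological statements of pp. 12–14 (deformation retracts, "locally an
embedding / a homeomorphism", coverings in the sense of algebraic topology); the characterisation
(p. 14) of immersive/excisive inclusions of sub-semi-graphs via `G_A[v_A] → G_B[v_B]`; pull-backs and
Galois graph-coverings (`ZariskiMainTheorem.lean`).
-/

namespace Literature.AnabelianGeometry.SemiGraphs

namespace SemiGraph

open CategoryTheory

universe u

variable (G : SemiGraph.{u})

/-- In a sub-semi-graph, a branch abuts to a vertex `w` iff it does so in `G` (p. 12 (b),(c)).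
[cite: MochizukiSemiAnbd2006, §1 p.12] -/
theorem Subgraph.abuts_eq_some_iff {G : SemiGraph.{u}} (H : G.Subgraph)
    (b : H.toSemiGraph.Branch) (w : H.toSemiGraph.Vertex) :
    H.toSemiGraph.abuts b = some w ↔ G.abuts b.1 = some w.1 := by
  change (G.abuts b.1).pbind _ = some w ↔ _
  cases hb : G.abuts b.1 with
  | none => simp
  | some x =>
    simp only [Option.pbind_some, Option.some.injEq]
    constructor
    · intro h
      split_ifs at h with hx
      · cases h; rfl
    · rintro rfl
      exact (dif_pos w.2).trans rfl

/-- The branch underlying the image of an abutting branch under the induced map on stars (p. 13).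
[cite: MochizukiSemiAnbd2006, §1 p.13] -/
theorem Hom.starMap_apply_val {G G' : SemiGraph.{u}} (φ : G ⟶ G') (v : G.Vertex) (b : G.Star v) :
    (Hom.starMap φ v b).1 = φ.branchMap b.1 := rfl

/-! ### Compactification (p. 13) -/

/-- The *compactification* of `G`: the graph obtained by appending, for each branch `b` of an edge
of `G` that does not abut to a vertex, a new vertex `v_b` to which `b` is to abut (p. 13).
[cite: MochizukiSemiAnbd2006, §1 p.13] -/
def compactification : SemiGraph.{u} where
  Vertex := G.Vertex ⊕ {b : G.Branch // G.abuts b = none}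
  Edge := G.Edge
  Branch := G.Branch
  edgeOf := G.edgeOf
  abuts b := if h : (G.abuts b).isSome then some (Sum.inl ((G.abuts b).get h))
    else some (Sum.inr ⟨b, Option.not_isSome_iff_eq_none.mp h⟩)
  two_branches := G.two_branches

/-- In the compactification an old abutment is kept. [cite: MochizukiSemiAnbd2006, §1 p.13] -/
theorem compactification_abuts_of_eq_some {b : G.Branch} {v : G.Vertex} (h : G.abuts b = some v) :
    G.compactification.abuts b = some (Sum.inl v) := by
  change dite _ _ _ = _
  have hs : (G.abuts b).isSome := by rw [h]; rfl
  rw [dif_pos hs]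
  simp [h]

/-- In the compactification a branch abutting to no vertex of `G` abuts to the new vertex `v_b`.
[cite: MochizukiSemiAnbd2006, §1 p.13] -/
theorem compactification_abuts_of_eq_none {b : G.Branch} (h : G.abuts b = none) :
    G.compactification.abuts b = some (Sum.inr ⟨b, h⟩) := by
  change dite _ _ _ = _
  have hs : ¬ ((G.abuts b).isSome) := by rw [h]; exact Bool.false_ne_true
  rw [dif_neg hs]

/-- The compactification of a semi-graph is a graph (p. 13: "the graph obtained from `G` by
appending …"). [cite: MochizukiSemiAnbd2006, §1 p.13] -/
theorem compactification_isGraph : G.compactification.IsGraph := by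
  refine ⟨fun b => ?_⟩
  change Option.isSome (dite _ _ _) = true
  split <;> rfl

/-- The natural morphism `G → G̅` into the compactification (identity on edges and branches).
[cite: MochizukiSemiAnbd2006, §1 p.13] -/
@[simps] def toCompactification : G ⟶ G.compactification where
  vertexMap := Sum.inl
  edgeMap := id
  branchMap := id
  edgeOf_branchMap _ := rfl
  branchMap_injOn _ _ _ h := h
  abuts_branchMap _ _ h := G.compactification_abuts_of_eq_some h

/-- NAMED FACT (p. 13): "Thus, `G` forms a sub-semi-graph of its compactification" — the morphism
`G → G̅` is an embedding. [cite: MochizukiSemiAnbd2006, §1 p.13] -/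
def toCompactification_isEmbedding : Prop :=
  ∀ G : SemiGraph.{u}, IsEmbedding G.toCompactification

variable {G} in
/-- The map of a branch abutting to no vertex under a morphism, read in the compactification of the
target: the vertex its image abuts to, or the new vertex of its image (p. 13).
[cite: MochizukiSemiAnbd2006, §1 p.13] -/
def compactificationVertexOfBranch {G' : SemiGraph.{u}} (φ : G ⟶ G') (b : G.Branch) :
    G'.compactification.Vertex :=
  if h : (G'.abuts (φ.branchMap b)).isSome then Sum.inl ((G'.abuts (φ.branchMap b)).get h)
  else Sum.inr ⟨φ.branchMap b, Option.not_isSome_iff_eq_none.mp h⟩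

variable {G} in
/-- The morphism of compactifications induced by a morphism of semi-graphs (p. 13): a new vertex
`v_b` goes to the vertex the image of `b` abuts to, or to the new vertex `v_{φ b}`.
[cite: MochizukiSemiAnbd2006, §1 p.13] -/
def compactificationMap {G' : SemiGraph.{u}} (φ : G ⟶ G') :
    G.compactification ⟶ G'.compactification where
  vertexMap := fun x => Sum.elim (fun v => Sum.inl (φ.vertexMap v))
    (fun b => compactificationVertexOfBranch φ b.1) x
  edgeMap := φ.edgeMap
  branchMap := φ.branchMap
  edgeOf_branchMap := φ.edgeOf_branchMap
  branchMap_injOn := φ.branchMap_injOn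
  abuts_branchMap b x hx := by
    cases hb : G.abuts b with
    | some v =>
      rw [G.compactification_abuts_of_eq_some hb] at hx
      cases hx
      exact G'.compactification_abuts_of_eq_some (φ.abuts_branchMap b v hb)
    | none =>
      rw [G.compactification_abuts_of_eq_none hb] at hx
      cases hx
      change G'.compactification.abuts (φ.branchMap b) = some (compactificationVertexOfBranch φ b)
      unfold compactificationVertexOfBranch
      by_cases hs : (G'.abuts (φ.branchMap b)).isSome
      · rw [dif_pos hs]
        exact G'.compactification_abuts_of_eq_some (Option.some_get hs).symm
      · rw [dif_neg hs]
        exact G'.compactification_abuts_of_eq_none (Option.not_isSome_iff_eq_none.mp hs)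

variable {G} in
/-- The induced morphism of compactifications extends the given morphism: `G → G̅ → G̅'` equals
`G → G' → G̅'`. [cite: MochizukiSemiAnbd2006, §1 p.13] -/
theorem toCompactification_comp_compactificationMap {G' : SemiGraph.{u}} (φ : G ⟶ G') :
    G.toCompactification ≫ compactificationMap φ = φ ≫ G'.toCompactification := rfl

/-- NAMED FACT (p. 13): "any morphism of semi-graphs induces a *unique* morphism between the
respective compactifications" — a morphism of compactifications extending `φ` is the induced one.
[cite: MochizukiSemiAnbd2006, §1 p.13] -/
def compactificationMap_unique : Prop :=
  ∀ (G G' : SemiGraph.{u}) (φ : G ⟶ G') (ψ : G.compactification ⟶ G'.compactification),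
    G.toCompactification ≫ ψ = φ ≫ G'.toCompactification → ψ = compactificationMap φ

/-! ### The local semi-graphs `G[v]`, `G[e]`, `G[b]` (p. 13) -/

open Classical in
/-- `G[v]` (p. 13): a single vertex `v'` (over `v`) and, for each branch `b_v` of an edge `e_v`
abutting to `v`, an edge `e'_{b_v}` of verticial cardinality `1` over `e_v` whose branch lying over
`b_v` abuts to `v'`.  Branches of `e'_{b_v}` = branches of `e_v`, tagged by `b_v`.
[cite: MochizukiSemiAnbd2006, §1 p.13] -/
noncomputable def atVertex (v : G.Vertex) : SemiGraph.{u} where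
  Vertex := PUnit
  Edge := G.Star v
  Branch := {p : G.Star v × G.Branch // G.edgeOf p.2 = G.edgeOf p.1.1}
  edgeOf p := p.1.1
  abuts p := if p.1.2 = p.1.1.1 then some PUnit.unit else none
  two_branches e := by
    obtain ⟨b₁, b₂, hne, h₁, h₂, hall⟩ := G.two_branches (G.edgeOf e.1)
    refine ⟨⟨(e, b₁), h₁⟩, ⟨(e, b₂), h₂⟩, fun h => hne (congrArg (fun p => p.1.2) h), rfl, rfl,
      fun p hp => ?_⟩
    have hp' : p.1.1 = e := hp
    rcases hall p.1.2 (p.2.trans (congrArg (fun x : G.Star v => G.edgeOf x.1) hp')) with h | h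
    · exact Or.inl (Subtype.ext (Prod.ext hp' h))
    · exact Or.inr (Subtype.ext (Prod.ext hp' h))

open Classical in
/-- In `G[v]`, the branch `c` of `e'_{b}` abuts to the vertex iff `c` lies over `b`.
[cite: MochizukiSemiAnbd2006, §1 p.13] -/
theorem atVertex_abuts_eq_some_iff (v : G.Vertex) (p : (G.atVertex v).Branch) (u : PUnit) :
    (G.atVertex v).abuts p = some u ↔ p.1.2 = p.1.1.1 := by
  change (if p.1.2 = p.1.1.1 then some PUnit.unit else none) = some u ↔ _
  constructor
  · intro h
    by_contra hne
    rw [if_neg hne] at h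
    cases h
  · intro h
    rw [if_pos h]

/-- The natural morphism `G[v] → G` (p. 13). [cite: MochizukiSemiAnbd2006, §1 p.13] -/
@[simps] noncomputable def atVertexHom (v : G.Vertex) : G.atVertex v ⟶ G where
  vertexMap _ := v
  edgeMap e := G.edgeOf e.1
  branchMap p := p.1.2
  edgeOf_branchMap p := p.2
  branchMap_injOn p q he h := Subtype.ext (Prod.ext he h)
  abuts_branchMap p u h := by
    rw [(G.atVertex_abuts_eq_some_iff v p u).mp h]
    exact p.1.1.2

open Classical in
/-- `G[e]` (p. 13): a single edge `e'` over `e`, whose branches are those of `e`, and, for each branch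
`b_e` of `e` abutting to a vertex `v_{b_e}` of `G`, a vertex `v'_{b_e}` over `v_{b_e}` which is the
abutment of the branch of `e'` lying over `b_e`. [cite: MochizukiSemiAnbd2006, §1 p.13] -/
noncomputable def atEdge (e : G.Edge) : SemiGraph.{u} where
  Vertex := {b : G.Branch // G.edgeOf b = e ∧ (G.abuts b).isSome}
  Edge := PUnit
  Branch := {b : G.Branch // G.edgeOf b = e}
  edgeOf _ := PUnit.unit
  abuts b := if h : (G.abuts b.1).isSome then some ⟨b.1, b.2, h⟩ else none
  two_branches _ := by
    obtain ⟨b₁, b₂, hne, h₁, h₂, hall⟩ := G.two_branches e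
    refine ⟨⟨b₁, h₁⟩, ⟨b₂, h₂⟩, fun h => hne (congrArg Subtype.val h), rfl, rfl, fun b _ => ?_⟩
    rcases hall b.1 b.2 with h | h
    · exact Or.inl (Subtype.ext h)
    · exact Or.inr (Subtype.ext h)

/-- In `G[e]`, the branch `c` abuts to the vertex `v'_{b}` iff `c = b`.
[cite: MochizukiSemiAnbd2006, §1 p.13] -/
theorem atEdge_abuts_eq_some_iff (e : G.Edge) (c : (G.atEdge e).Branch) (w : (G.atEdge e).Vertex) :
    (G.atEdge e).abuts c = some w ↔ c.1 = w.1 := by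
  change (if h : (G.abuts c.1).isSome then some (⟨c.1, c.2, h⟩ : (G.atEdge e).Vertex) else none)
    = some w ↔ _
  constructor
  · intro h
    split_ifs at h with hc
    cases h; rfl
  · intro h
    have hc : (G.abuts c.1).isSome := by rw [h]; exact w.2.2
    rw [dif_pos hc]
    congr 1
    exact Subtype.ext h

/-- The natural morphism `G[e] → G` (p. 13). [cite: MochizukiSemiAnbd2006, §1 p.13] -/
@[simps] noncomputable def atEdgeHom (e : G.Edge) : G.atEdge e ⟶ G where
  vertexMap w := (G.abuts w.1).get w.2.2
  edgeMap _ := e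
  branchMap b := b.1
  edgeOf_branchMap b := b.2
  branchMap_injOn _ _ _ h := Subtype.ext h
  abuts_branchMap b w h := by
    have h' := (G.atEdge_abuts_eq_some_iff e b w).mp h
    rw [h']
    exact (Option.some_get w.2.2).symm

/-- `G[b]` for a branch `b` (of the edge `e_b`) abutting to a vertex: the sub-semi-graph of `G[e_b]`
consisting of its unique edge and the vertex which is the abutment of the branch lying over `b`
(p. 13). [cite: MochizukiSemiAnbd2006, §1 p.13] -/
def atBranch (b : G.Branch) (hb : (G.abuts b).isSome) : (G.atEdge (G.edgeOf b)).Subgraph where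
  verts := {⟨b, rfl, hb⟩}
  edges := Set.univ

/-- The natural morphism `G[b] → G[e]` over `G`: the inclusion of the sub-semi-graph (p. 13).
[cite: MochizukiSemiAnbd2006, §1 p.13] -/
noncomputable abbrev atBranchToAtEdge (b : G.Branch) (hb : (G.abuts b).isSome) :
    (G.atBranch b hb).toSemiGraph ⟶ G.atEdge (G.edgeOf b) :=
  (G.atBranch b hb).ι

/-- The natural morphism `G[b] → G` (p. 13). [cite: MochizukiSemiAnbd2006, §1 p.13] -/
noncomputable abbrev atBranchHom (b : G.Branch) (hb : (G.abuts b).isSome) :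
    (G.atBranch b hb).toSemiGraph ⟶ G :=
  (G.atBranch b hb).ι ≫ G.atEdgeHom (G.edgeOf b)

/-- In `G[b]`, a branch `c` abuts to the (unique) vertex iff `c` lies over `b`.
[cite: MochizukiSemiAnbd2006, §1 p.13] -/
theorem atBranch_abuts_eq_some_iff (b : G.Branch) (hb : (G.abuts b).isSome)
    (c : (G.atBranch b hb).toSemiGraph.Branch) (w : (G.atBranch b hb).toSemiGraph.Vertex) :
    (G.atBranch b hb).toSemiGraph.abuts c = some w ↔ c.1.1 = b := by
  rw [Subgraph.abuts_eq_some_iff, atEdge_abuts_eq_some_iff]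
  have hw : w.1 = ⟨b, rfl, hb⟩ := w.2
  rw [hw]

/-- The natural morphism `G[b] → G[v]` over `G`, for `b` abutting to the vertex `v = ζ(b)` (p. 13):
the unique edge goes to the edge `e'_b` of `G[v]`, a branch `c` to the branch `c` of `e'_b`.
[cite: MochizukiSemiAnbd2006, §1 p.13] -/
@[simps] noncomputable def atBranchToAtVertex (b : G.Branch) (hb : (G.abuts b).isSome) :
    (G.atBranch b hb).toSemiGraph ⟶ G.atVertex ((G.abuts b).get hb) where
  vertexMap _ := PUnit.unit
  edgeMap _ := ⟨b, (Option.some_get hb).symm⟩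
  branchMap c := ⟨(⟨b, (Option.some_get hb).symm⟩, c.1.1), c.1.2⟩
  edgeOf_branchMap _ := rfl
  branchMap_injOn _ _ _ h :=
    Subtype.ext (Subtype.ext (congrArg (fun p : {p : G.Star ((G.abuts b).get hb) × G.Branch //
      G.edgeOf p.2 = G.edgeOf p.1.1} => p.1.2) h))
  abuts_branchMap c w h :=
    (G.atVertex_abuts_eq_some_iff _ _ _).mpr ((G.atBranch_abuts_eq_some_iff b hb c w).mp h)

/-! ### The observations of p. 14 -/

/-- "`G[v] → G` … [is] immersive; … always excisive" (p. 14). [cite: MochizukiSemiAnbd2006, §1 p.14] -/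
theorem atVertexHom_isExcision (v : G.Vertex) : IsExcision (G.atVertexHom v) := by
  intro u
  constructor
  · rintro ⟨p, hp⟩ ⟨q, hq⟩ h
    have hp' := (G.atVertex_abuts_eq_some_iff v p u).mp hp
    have hq' := (G.atVertex_abuts_eq_some_iff v q u).mp hq
    have hval : p.1.2 = q.1.2 := congrArg Subtype.val h
    apply Subtype.ext; apply Subtype.ext
    exact Prod.ext (Subtype.ext (hp'.symm.trans (hval.trans hq'))) hval
  · rintro ⟨c, hc⟩
    exact ⟨⟨⟨(⟨c, hc⟩, c), rfl⟩, (G.atVertex_abuts_eq_some_iff v _ u).mpr rfl⟩, rfl⟩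

/-- "`G[e] → G` … [is] immersive" (p. 14). [cite: MochizukiSemiAnbd2006, §1 p.14] -/
theorem atEdgeHom_isImmersion (e : G.Edge) : IsImmersion (G.atEdgeHom e) := by
  rintro w ⟨c, hc⟩ ⟨c', hc'⟩ h
  have h' := congrArg Subtype.val h
  simp only [Hom.starMap_apply_val, atEdgeHom_branchMap] at h'
  exact Subtype.ext (Subtype.ext h')

/-- "`G[b] → G[e]` … [is] immersive; … always excisive" (p. 14).
[cite: MochizukiSemiAnbd2006, §1 p.14] -/
theorem atBranchToAtEdge_isExcision (b : G.Branch) (hb : (G.abuts b).isSome) :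
    IsExcision (G.atBranchToAtEdge b hb) := by
  intro w
  constructor
  · rintro ⟨c, hc⟩ ⟨c', hc'⟩ h
    have h' := congrArg Subtype.val h
    simp only [Hom.starMap_apply_val] at h'
    exact Subtype.ext (Subtype.ext h')
  · rintro ⟨c, hc⟩
    refine ⟨⟨⟨c, trivial⟩, ?_⟩, rfl⟩
    rw [Subgraph.abuts_eq_some_iff]
    exact hc

/-- "`G[b] → G` … [is] immersive" (p. 14). [cite: MochizukiSemiAnbd2006, §1 p.14] -/
theorem atBranchHom_isImmersion (b : G.Branch) (hb : (G.abuts b).isSome) :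
    IsImmersion (G.atBranchHom b hb) := by
  rintro w ⟨c, hc⟩ ⟨c', hc'⟩ h
  have h' := congrArg Subtype.val h
  simp only [Hom.starMap_apply_val, comp_branchMap, Function.comp_apply, atEdgeHom_branchMap] at h'
  exact Subtype.ext (Subtype.ext (Subtype.ext h'))

/-- "`G[b] → G[v]` … [is] immersive" (p. 14). [cite: MochizukiSemiAnbd2006, §1 p.14] -/
theorem atBranchToAtVertex_isImmersion (b : G.Branch) (hb : (G.abuts b).isSome) :
    IsImmersion (G.atBranchToAtVertex b hb) := by
  rintro w ⟨c, hc⟩ ⟨c', hc'⟩ h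
  have h' : (⟨(⟨b, (Option.some_get hb).symm⟩, c.1.1), c.1.2⟩ : (G.atVertex _).Branch) =
      ⟨(⟨b, (Option.some_get hb).symm⟩, c'.1.1), c'.1.2⟩ := congrArg Subtype.val h
  have h'' := congrArg (fun p : (G.atVertex ((G.abuts b).get hb)).Branch => p.1.2) h'
  exact Subtype.ext (Subtype.ext (Subtype.ext h''))

/-- NAMED FACT (p. 13): "`G[v]`, `G[e]`, `G[b]` are all trees [even if `G` fails to be untangled]".
[cite: MochizukiSemiAnbd2006, §1 p.13] -/
def atVertex_atEdge_atBranch_isTree : Prop :=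
  ∀ G : SemiGraph.{u}, (∀ v, (G.atVertex v).IsTree) ∧ (∀ e, (G.atEdge e).IsTree) ∧
    ∀ b hb, ((G.atBranch b hb).toSemiGraph).IsTree

end SemiGraph

end Literature.AnabelianGeometry.SemiGraphs
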